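import Summits.CriticalPhenomena.Ising3DConformalLimit.Theorems.ReflectionTwinTwinThresholdPlaneSummableRenewalLemmas
import HarnessLib

/-!
# Seam renewal for the (111) reflection twin, II: degree bounds and Lieb–Simon renewal in a box

Crux `TwinThreshold` (stmt-CriticalPhenomena-16906), line `seam_renewal`, stub (W2) `stub_planeSummable_of_surfaceSummable`,
continued from `ReflectionTwinTwinThresholdPlaneSummableRenewalLemmas.lean` (objects there). In the box `Λ_L` with the
twin couplings `c = twinCpl J L` (`J ≥ 0`, all entries `≥ 0`):

* pointwise bounds on the symmetrised couplings `c_{ab} + c_{ba}` by `β_c J` times neighbour indicators (`cpl_plane_le`,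
  `cpl_lower_le`, `cpl_upper_le`) and the layer bookkeeping (`layer_of_cpl_*`);
* weighted degrees (`degree_plane`: `∑_v (c_{av} + c_{va}) ≤ 6 β_c J` at a plane site; `degree_lower` / `degree_upper`: `≤ 3 β_c J`
  from layer `∓1` across the plane, `0` from deeper layers), by summing the indicators over the box (`sum_ite_eq_le`);
* **renewal** — the tree's Lieb–Simon inequality `PairIsing.liebSimon` (two-sided outer factor) with `B = {a}` summed over the
  plane (`renewal_site`: `S(a) ≤ 1 + ∑_v (c_{av}+c_{va})(S(a)+S(v))`) and with `B` a part of the box missing the plane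
  (`renewal_half`: `S(v) ≤ ∑_{u ∈ B} ∑_{w ∉ B} (c_{uw}+c_{wu}) ⟨σ_vσ_u⟩_{c|_B} (S(u)+S(w))`).

Sources: Aizenman–Duminil-Copin, Ann. of Math. 194 (2021), Lemma 5.7; Simon / Lieb, Comm. Math. Phys. 77 (1980); Friedli–Velenik
(2017), Thm. 3.49. Proofs only.
-/

noncomputable section

namespace Summit.CriticalPhenomena.Ising3DConformalLimit.Cruxes.TwinThreshold.SeamRenewal.PlaneSummable

open scoped BigOperators Classical
open Filter Topology Finset
open Literature.Probability.LatticeModels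
open Summit.CriticalPhenomena.Ising3DConformalLimit.Cruxes.ExistsScaleCovariantLimit.DecimationHomotopyRate

/-! ## The seam couplings: sign, size, and neighbour indicators -/

/-- `twinW ≥ 0` for `J ≥ 0`. [folklore] -/
theorem twinW_nonneg {J : ℝ} (hJ : 0 ≤ J) (a b : Site 3) : 0 ≤ twinW J a b := by
  have hβ : 0 ≤ criticalBeta 3 := criticalBeta_nonneg 3
  unfold twinW
  split_ifs
  · exact mul_nonneg (by positivity) hJ
  · exact mul_nonneg (by positivity) zero_le_one
  · exact le_rfl

/-- A bond with a plane endpoint carries `β_c J / 2` per orientation (at most). [folklore] -/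
theorem twinW_le_of_plane {J : ℝ} (hJ : 0 ≤ J) {a b : Site 3} (h : hh a = 0 ∨ hh b = 0) :
    twinW J a b ≤ criticalBeta 3 / 2 * J := by
  have hβ : 0 ≤ criticalBeta 3 := criticalBeta_nonneg 3
  unfold twinW
  split_ifs with h1 h2
  · exact le_rfl
  · exact absurd h h2
  · exact mul_nonneg (by positivity) hJ

/-- The n.n. coupling is invariant under `z ↦ -z`. [folklore] -/
theorem halfW_neg (a b : Site 3) : halfW (-a) (-b) = halfW a b := by
  have : ∑ i, |(-a) i - (-b) i| = ∑ i, |a i - b i| :=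
    Finset.sum_congr rfl fun i _ => by rw [Pi.neg_apply, Pi.neg_apply, neg_sub_neg, abs_sub_comm]
  unfold halfW
  rw [this]

/-- Plane sites: the symmetrised coupling is at most `β_c J` times the indicator of the six twin neighbours
`a - e_i`, `e_i - a`. [folklore] -/
theorem cpl_plane_le {J : ℝ} (hJ : 0 ≤ J) {a : Site 3} (ha : hh a = 0) (b : Site 3) :
    twinW J a b + twinW J b a ≤ (criticalBeta 3 * J) *
      ∑ i : Fin 3, ((if b = a - ee i then (1 : ℝ) else 0) + (if b = ee i - a then (1 : ℝ) else 0)) := by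
  have ht : 0 ≤ criticalBeta 3 * J := mul_nonneg (criticalBeta_nonneg 3) hJ
  have h0 : ∀ i, (0 : ℝ) ≤ (if b = a - ee i then (1 : ℝ) else 0) := fun i => by split_ifs <;> norm_num
  have h0' : ∀ i, (0 : ℝ) ≤ (if b = ee i - a then (1 : ℝ) else 0) := fun i => by split_ifs <;> norm_num
  have hnn : ∀ i ∈ (univ : Finset (Fin 3)),
      (0 : ℝ) ≤ (if b = a - ee i then (1 : ℝ) else 0) + (if b = ee i - a then (1 : ℝ) else 0) :=
    fun i _ => add_nonneg (h0 i) (h0' i)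
  by_cases hz : twinW J a b + twinW J b a = 0
  · rw [hz]; exact mul_nonneg ht (Finset.sum_nonneg hnn)
  · have h1 : (1 : ℝ) ≤
        ∑ i : Fin 3, ((if b = a - ee i then (1 : ℝ) else 0) + (if b = ee i - a then (1 : ℝ) else 0)) := by
      rcases plane_nbr_of_cpl_ne_zero ha hz with ⟨i, hi⟩ | ⟨i, hi⟩
      · refine le_trans ?_ (Finset.single_le_sum hnn (Finset.mem_univ i))
        rw [if_pos hi]; linarith [h0' i]
      · refine le_trans ?_ (Finset.single_le_sum hnn (Finset.mem_univ i))
        rw [if_pos hi]; linarith [h0 i]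
    calc twinW J a b + twinW J b a ≤ criticalBeta 3 / 2 * J + criticalBeta 3 / 2 * J :=
          add_le_add (twinW_le_of_plane hJ (Or.inl ha)) (twinW_le_of_plane hJ (Or.inr ha))
      _ = (criticalBeta 3 * J) * 1 := by ring
      _ ≤ _ := mul_le_mul_of_nonneg_left h1 ht

/-- Layer `-1` sites: the symmetrised coupling to `{h ≥ 0}` is at most `β_c J` times the indicator of `a + e_i`;
deeper sites do not couple to `{h ≥ 0}`. [folklore] -/
theorem cpl_lower_le {J : ℝ} (hJ : 0 ≤ J) {a b : Site 3} (ha : hh a ≤ -1) (hb : 0 ≤ hh b) :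
    twinW J a b + twinW J b a ≤
      if hh a = -1 then (criticalBeta 3 * J) * ∑ i : Fin 3, (if b = a + ee i then (1 : ℝ) else 0) else 0 := by
  have ht : 0 ≤ criticalBeta 3 * J := mul_nonneg (criticalBeta_nonneg 3) hJ
  have hnn : ∀ i ∈ (univ : Finset (Fin 3)), (0 : ℝ) ≤ (if b = a + ee i then (1 : ℝ) else 0) :=
    fun i _ => by split_ifs <;> norm_num
  by_cases hz : twinW J a b + twinW J b a = 0
  · rw [hz]
    split_ifs
    · exact mul_nonneg ht (Finset.sum_nonneg hnn)
    · exact le_rfl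
  · obtain ⟨ha1, i, hi⟩ := lower_nbr_of_cpl_ne_zero ha hb hz
    have hb0 : hh b = 0 := by rw [hi, hh_add, hh_ee, ha1]; norm_num
    rw [if_pos ha1]
    have h1 : (1 : ℝ) ≤ ∑ i : Fin 3, (if b = a + ee i then (1 : ℝ) else 0) :=
      le_trans (by rw [if_pos hi]) (Finset.single_le_sum hnn (Finset.mem_univ i))
    calc twinW J a b + twinW J b a ≤ criticalBeta 3 / 2 * J + criticalBeta 3 / 2 * J :=
          add_le_add (twinW_le_of_plane hJ (Or.inr hb0)) (twinW_le_of_plane hJ (Or.inl hb0))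
      _ = (criticalBeta 3 * J) * 1 := by ring
      _ ≤ _ := mul_le_mul_of_nonneg_left h1 ht

/-- Layer `1` sites: the symmetrised coupling to `{h ≤ 0}` is at most `β_c J` times the indicator of the seam
partners `e_i - a`; higher sites do not couple to `{h ≤ 0}`. [folklore] -/
theorem cpl_upper_le {J : ℝ} (hJ : 0 ≤ J) {a b : Site 3} (ha : 1 ≤ hh a) (hb : hh b ≤ 0) :
    twinW J a b + twinW J b a ≤
      if hh a = 1 then (criticalBeta 3 * J) * ∑ i : Fin 3, (if b = ee i - a then (1 : ℝ) else 0) else 0 := by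
  have ht : 0 ≤ criticalBeta 3 * J := mul_nonneg (criticalBeta_nonneg 3) hJ
  have hnn : ∀ i ∈ (univ : Finset (Fin 3)), (0 : ℝ) ≤ (if b = ee i - a then (1 : ℝ) else 0) :=
    fun i _ => by split_ifs <;> norm_num
  by_cases hz : twinW J a b + twinW J b a = 0
  · rw [hz]
    split_ifs
    · exact mul_nonneg ht (Finset.sum_nonneg hnn)
    · exact le_rfl
  · obtain ⟨ha1, i, hi⟩ := upper_nbr_of_cpl_ne_zero ha hb hz
    have hb0 : hh b = 0 := by rw [hi, hh_sub, hh_ee, ha1]; norm_num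
    rw [if_pos ha1]
    have h1 : (1 : ℝ) ≤ ∑ i : Fin 3, (if b = ee i - a then (1 : ℝ) else 0) :=
      le_trans (by rw [if_pos hi]) (Finset.single_le_sum hnn (Finset.mem_univ i))
    calc twinW J a b + twinW J b a ≤ criticalBeta 3 / 2 * J + criticalBeta 3 / 2 * J :=
          add_le_add (twinW_le_of_plane hJ (Or.inr hb0)) (twinW_le_of_plane hJ (Or.inl hb0))
      _ = (criticalBeta 3 * J) * 1 := by ring
      _ ≤ _ := mul_le_mul_of_nonneg_left h1 ht

/-- A plane site couples only to layers `±1`. [folklore] -/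
theorem layer_of_cpl_plane {J : ℝ} {a b : Site 3} (ha : hh a = 0) (h : twinW J a b + twinW J b a ≠ 0) :
    hh b = -1 ∨ hh b = 1 := by
  rcases plane_nbr_of_cpl_ne_zero ha h with ⟨i, hi⟩ | ⟨i, hi⟩
  · left; rw [hi, hh_sub, hh_ee, ha]; norm_num
  · right; rw [hi, hh_sub, hh_ee, ha]; norm_num

/-- A bond from `{h ≤ -1}` to `{h ≥ 0}` joins layer `-1` to the plane. [folklore] -/
theorem layer_of_cpl_lower {J : ℝ} {a b : Site 3} (ha : hh a ≤ -1) (hb : 0 ≤ hh b)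
    (h : twinW J a b + twinW J b a ≠ 0) : hh a = -1 ∧ hh b = 0 := by
  obtain ⟨ha1, i, hi⟩ := lower_nbr_of_cpl_ne_zero ha hb h
  exact ⟨ha1, by rw [hi, hh_add, hh_ee, ha1]; norm_num⟩

/-- A bond from `{h ≥ 1}` to `{h ≤ 0}` joins layer `1` to the plane. [folklore] -/
theorem layer_of_cpl_upper {J : ℝ} {a b : Site 3} (ha : 1 ≤ hh a) (hb : hh b ≤ 0)
    (h : twinW J a b + twinW J b a ≠ 0) : hh a = 1 ∧ hh b = 0 := by
  obtain ⟨ha1, i, hi⟩ := upper_nbr_of_cpl_ne_zero ha hb h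
  exact ⟨ha1, by rw [hi, hh_sub, hh_ee, ha1]; norm_num⟩

/-! ## Counting neighbours inside a box -/

/-- A one-site indicator sums to at most the bound of its weight over the box. [folklore] -/
theorem sum_ite_eq_le {L : ℕ} (y : Site 3) {w : ↥(box 3 L) → ℝ} {K : ℝ} (hK : 0 ≤ K) (hw : ∀ v, w v ≤ K) :
    ∑ v : ↥(box 3 L), (if v.1 = y then w v else 0) ≤ K := by
  by_cases hy : y ∈ box 3 L
  · rw [Finset.sum_eq_single (⟨y, hy⟩ : ↥(box 3 L)), if_pos rfl]
    · exact hw _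
    · exact fun v _ hv => if_neg fun h : v.1 = y => hv (Subtype.ext h)
    · exact fun h => absurd (Finset.mem_univ _) h
  · exact (Finset.sum_eq_zero fun v _ => if_neg fun h : v.1 = y => hy (h ▸ v.2)).trans_le hK

/-- Summing a bound by `t` times the indicator of three sites over part of the box gives at most `3t`. [folklore] -/
theorem sum_le_three_mul {L : ℕ} {T : Finset ↥(box 3 L)} {f : ↥(box 3 L) → ℝ} {t : ℝ} (ht : 0 ≤ t) (g : Fin 3 → Site 3)
    (hf : ∀ w ∈ T, f w ≤ t * ∑ i : Fin 3, (if w.1 = g i then (1 : ℝ) else 0)) : ∑ w ∈ T, f w ≤ 3 * t :=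
  calc ∑ w ∈ T, f w ≤ ∑ w ∈ T, t * ∑ i : Fin 3, (if w.1 = g i then (1 : ℝ) else 0) := Finset.sum_le_sum hf
    _ ≤ ∑ w : ↥(box 3 L), t * ∑ i : Fin 3, (if w.1 = g i then (1 : ℝ) else 0) :=
        Finset.sum_le_univ_sum_of_nonneg fun w => mul_nonneg ht (Finset.sum_nonneg fun i _ => by split_ifs <;> norm_num)
    _ = t * ∑ i : Fin 3, ∑ w : ↥(box 3 L), (if w.1 = g i then (1 : ℝ) else 0) := by rw [← Finset.mul_sum, Finset.sum_comm]
    _ ≤ t * ∑ _i : Fin 3, (1 : ℝ) :=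
        mul_le_mul_of_nonneg_left (Finset.sum_le_sum fun i _ => sum_ite_eq_le _ zero_le_one fun _ => le_rfl) ht
    _ = 3 * t := by rw [Fin.sum_univ_three]; ring

/-- Weighted twin degree of a plane site: `∑_v (c_{av} + c_{va}) ≤ 6 β_c J`. [folklore] -/
theorem degree_plane {J : ℝ} (hJ : 0 ≤ J) {L : ℕ} (a : ↥(box 3 L)) (ha : hh a.1 = 0) :
    ∑ v : ↥(box 3 L), (twinW J a.1 v.1 + twinW J v.1 a.1) ≤ 6 * (criticalBeta 3 * J) := by
  have ht : 0 ≤ criticalBeta 3 * J := mul_nonneg (criticalBeta_nonneg 3) hJ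
  calc ∑ v : ↥(box 3 L), (twinW J a.1 v.1 + twinW J v.1 a.1)
      ≤ ∑ v : ↥(box 3 L), (criticalBeta 3 * J) *
          ∑ i : Fin 3, ((if v.1 = a.1 - ee i then (1 : ℝ) else 0) + (if v.1 = ee i - a.1 then (1 : ℝ) else 0)) :=
        Finset.sum_le_sum fun v _ => cpl_plane_le hJ ha v.1
    _ = (criticalBeta 3 * J) * ∑ i : Fin 3, ((∑ v : ↥(box 3 L), if v.1 = a.1 - ee i then (1 : ℝ) else 0) +
          ∑ v : ↥(box 3 L), if v.1 = ee i - a.1 then (1 : ℝ) else 0) := by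
        rw [← Finset.mul_sum, Finset.sum_comm]
        simp only [Finset.sum_add_distrib]
    _ ≤ (criticalBeta 3 * J) * ∑ _i : Fin 3, ((1 : ℝ) + 1) :=
        mul_le_mul_of_nonneg_left (Finset.sum_le_sum fun i _ => add_le_add
          (sum_ite_eq_le _ zero_le_one fun _ => le_rfl) (sum_ite_eq_le _ zero_le_one fun _ => le_rfl)) ht
    _ = 6 * (criticalBeta 3 * J) := by rw [Fin.sum_univ_three]; ring

/-- Weighted degree of a site of `{h ≤ -1}` towards `{h ≥ 0}`: `≤ 3 β_c J` on layer `-1`, zero below. [folklore] -/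
theorem degree_lower {J : ℝ} (hJ : 0 ≤ J) {L : ℕ} (u : ↥(box 3 L)) (hu : hh u.1 ≤ -1) (T : Finset ↥(box 3 L))
    (hT : ∀ w ∈ T, 0 ≤ hh w.1) :
    ∑ w ∈ T, (twinW J u.1 w.1 + twinW J w.1 u.1) ≤ if hh u.1 = -1 then 3 * (criticalBeta 3 * J) else 0 := by
  have ht : 0 ≤ criticalBeta 3 * J := mul_nonneg (criticalBeta_nonneg 3) hJ
  split_ifs with hu1
  · exact sum_le_three_mul ht (fun i => u.1 + ee i) fun w hw => by
      have h := cpl_lower_le hJ hu (hT w hw); rwa [if_pos hu1] at h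
  · refine (Finset.sum_eq_zero fun w hw => ?_).le
    have h := cpl_lower_le hJ hu (hT w hw)
    rw [if_neg hu1] at h
    exact le_antisymm h (add_nonneg (twinW_nonneg hJ _ _) (twinW_nonneg hJ _ _))

/-- Weighted degree of a site of `{h ≥ 1}` towards `{h ≤ 0}`: `≤ 3 β_c J` on layer `1`, zero above. [folklore] -/
theorem degree_upper {J : ℝ} (hJ : 0 ≤ J) {L : ℕ} (u : ↥(box 3 L)) (hu : 1 ≤ hh u.1) (T : Finset ↥(box 3 L))
    (hT : ∀ w ∈ T, hh w.1 ≤ 0) :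
    ∑ w ∈ T, (twinW J u.1 w.1 + twinW J w.1 u.1) ≤ if hh u.1 = 1 then 3 * (criticalBeta 3 * J) else 0 := by
  have ht : 0 ≤ criticalBeta 3 * J := mul_nonneg (criticalBeta_nonneg 3) hJ
  split_ifs with hu1
  · exact sum_le_three_mul ht (fun i => ee i - u.1) fun w hw => by
      have h := cpl_upper_le hJ hu (hT w hw); rwa [if_pos hu1] at h
  · refine (Finset.sum_eq_zero fun w hw => ?_).le
    have h := cpl_upper_le hJ hu (hT w hw)
    rw [if_neg hu1] at h
    exact le_antisymm h (add_nonneg (twinW_nonneg hJ _ _) (twinW_nonneg hJ _ _))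

/-! ## The twin model on a box -/

/-- The twin coupling matrix is nonnegative for `J ≥ 0`. [folklore] -/
theorem twinCpl_nonneg {J : ℝ} (hJ : 0 ≤ J) (L : ℕ) (a b : ↥(box 3 L)) : 0 ≤ twinCpl J L a b :=
  twinW_nonneg hJ a.1 b.1

/-- `0 ≤ ⟨σ_xσ_y⟩`. [cite: FriedliVelenik2017, Thm. 3.49, eq. (3.54)] -/
theorem Gi_nonneg {J : ℝ} (hJ : 0 ≤ J) (L : ℕ) (x y : ↥(box 3 L)) : 0 ≤ Gi J L x y :=
  (PairIsing.avg_spinPair_mem (twinCpl J L) (twinCpl_nonneg hJ L) x y).1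

/-- `⟨σ_xσ_x⟩ = 1`. [folklore] -/
theorem Gi_self (J : ℝ) (L : ℕ) (x : ↥(box 3 L)) : Gi J L x x = 1 := by
  have : spinPair x x = fun _ => (1 : ℝ) := funext fun σ => spinAt_mul_self x σ
  unfold Gi; rw [this, PairIsing.avg_const]

/-- `S(x) ≥ 0`. [folklore] -/
theorem Ssum_nonneg {J : ℝ} (hJ : 0 ≤ J) (L : ℕ) (x : ↥(box 3 L)) : 0 ≤ Ssum J L x :=
  Finset.sum_nonneg fun z _ => Gi_nonneg hJ L x z

/-- `0 ≤ ⟨σ_xσ_y⟩_{c|_B}` for the restricted twin couplings. [cite: FriedliVelenik2017, Thm. 3.49, eq. (3.54)] -/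
theorem avgB_nonneg {J : ℝ} (hJ : 0 ≤ J) (L : ℕ) (B : Finset ↥(box 3 L)) (x y : ↥B) :
    0 ≤ PairIsing.avg (fun a' b' : ↥B => twinCpl J L a' b') (spinPair x y) :=
  (PairIsing.avg_spinPair_mem (fun a' b' : ↥B => twinCpl J L a' b') (fun a' b' => twinCpl_nonneg hJ L a'.1 b'.1) x y).1

/-- `⟨σ_xσ_y⟩_{c|_B} ≤ 1` for the restricted twin couplings. [folklore] -/
theorem avgB_le_one {J : ℝ} (hJ : 0 ≤ J) (L : ℕ) (B : Finset ↥(box 3 L)) (x y : ↥B) :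
    PairIsing.avg (fun a' b' : ↥B => twinCpl J L a' b') (spinPair x y) ≤ 1 :=
  (PairIsing.avg_spinPair_mem (fun a' b' : ↥B => twinCpl J L a' b') (fun a' b' => twinCpl_nonneg hJ L a'.1 b'.1) x y).2

/-! ## Lieb–Simon renewal across the seam -/

/-- **The one-site Lieb–Simon bound** for a nonnegative pair interaction on a finite set: for `z ≠ a`,
`⟨σ_aσ_z⟩ ≤ ∑_v (c_{av} + c_{va}) (⟨σ_aσ_z⟩ + ⟨σ_vσ_z⟩)` (the tree's `PairIsing.liebSimon` with `B = {a}`, the restricted one-site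
state bounded by `1`). [cite: AizenmanDuminilCopinAnnals2021, Lemma 5.7] -/
theorem liebSimon_singleton {ι : Type} [Fintype ι] [DecidableEq ι] (c : ι → ι → ℝ) (hc : ∀ a b, 0 ≤ c a b)
    {a z : ι} (hz : z ≠ a) :
    PairIsing.avg c (spinPair a z) ≤
      ∑ v, (c a v + c v a) * (PairIsing.avg c (spinPair a z) + PairIsing.avg c (spinPair v z)) := by
  have hG : ∀ x y : ι, 0 ≤ PairIsing.avg c (spinPair x y) := fun x y => (PairIsing.avg_spinPair_mem c hc x y).1
  have hLS := PairIsing.liebSimon c (fun a b _ => hc a b) {a} (Finset.mem_singleton_self a)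
    (fun h => hz (Finset.mem_singleton.1 h))
  refine hLS.trans ?_
  calc ∑ u : ↥({a} : Finset ι), ∑ v ∈ ({a} : Finset ι)ᶜ, (c u v + c v u) *
          PairIsing.avg (fun a' b' : ↥({a} : Finset ι) => c a' b') (spinPair ⟨a, Finset.mem_singleton_self a⟩ u) *
          (PairIsing.avg c (spinPair (u : ι) z) + PairIsing.avg c (spinPair v z))
      ≤ ∑ u : ↥({a} : Finset ι), ∑ v ∈ ({a} : Finset ι)ᶜ, (c u v + c v u) *
          (PairIsing.avg c (spinPair (u : ι) z) + PairIsing.avg c (spinPair v z)) :=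
        Finset.sum_le_sum fun u _ => Finset.sum_le_sum fun v _ =>
          mul_le_mul_of_nonneg_right
            (mul_le_of_le_one_right (add_nonneg (hc _ _) (hc _ _))
              (PairIsing.avg_spinPair_mem (fun a' b' : ↥({a} : Finset ι) => c a' b')
                (fun a' b' => hc a'.1 b'.1) _ _).2)
            (add_nonneg (hG _ z) (hG v z))
    _ = ∑ v ∈ ({a} : Finset ι)ᶜ, (c a v + c v a) * (PairIsing.avg c (spinPair a z) + PairIsing.avg c (spinPair v z)) := by
        rw [Finset.sum_coe_sort ({a} : Finset ι) (fun u => ∑ v ∈ ({a} : Finset ι)ᶜ, (c u v + c v u) *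
          (PairIsing.avg c (spinPair u z) + PairIsing.avg c (spinPair v z))), Finset.sum_singleton]
    _ ≤ ∑ v, (c a v + c v a) * (PairIsing.avg c (spinPair a z) + PairIsing.avg c (spinPair v z)) :=
        Finset.sum_le_univ_sum_of_nonneg fun v => mul_nonneg (add_nonneg (hc _ _) (hc _ _))
          (add_nonneg (hG a z) (hG v z))

/-- **One-site renewal** (Lieb–Simon with `B = {a}`, two-sided outer factor), summed over the plane:
`S(a) ≤ 1 + ∑_v (c_{av} + c_{va}) (S(a) + S(v))`. [cite: AizenmanDuminilCopinAnnals2021, Lemma 5.7] -/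
theorem renewal_site {J : ℝ} (hJ : 0 ≤ J) (L : ℕ) (a : ↥(box 3 L)) :
    Ssum J L a ≤ 1 + ∑ v : ↥(box 3 L), (twinW J a.1 v.1 + twinW J v.1 a.1) * (Ssum J L a + Ssum J L v) := by
  have hc := twinCpl_nonneg hJ L
  have hcc : ∀ u v : ↥(box 3 L), 0 ≤ twinW J u.1 v.1 + twinW J v.1 u.1 :=
    fun u v => add_nonneg (twinW_nonneg hJ _ _) (twinW_nonneg hJ _ _)
  have key : ∀ z : ↥(box 3 L), Gi J L a z ≤ (if z = a then (1 : ℝ) else 0) +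
      ∑ v : ↥(box 3 L), (twinW J a.1 v.1 + twinW J v.1 a.1) * (Gi J L a z + Gi J L v z) := by
    intro z
    have hnn : 0 ≤ ∑ v : ↥(box 3 L), (twinW J a.1 v.1 + twinW J v.1 a.1) * (Gi J L a z + Gi J L v z) :=
      Finset.sum_nonneg fun v _ => mul_nonneg (hcc a v) (add_nonneg (Gi_nonneg hJ L a z) (Gi_nonneg hJ L v z))
    by_cases hz : z = a
    · subst hz; rw [if_pos rfl]; linarith [Gi_self J L z]
    · rw [if_neg hz, zero_add]
      exact liebSimon_singleton (twinCpl J L) hc hz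
  calc Ssum J L a = ∑ z ∈ Pl L, Gi J L a z := rfl
    _ ≤ ∑ z ∈ Pl L, ((if z = a then (1 : ℝ) else 0) +
          ∑ v : ↥(box 3 L), (twinW J a.1 v.1 + twinW J v.1 a.1) * (Gi J L a z + Gi J L v z)) :=
        Finset.sum_le_sum fun z _ => key z
    _ = (∑ z ∈ Pl L, if z = a then (1 : ℝ) else 0) +
          ∑ v : ↥(box 3 L), (twinW J a.1 v.1 + twinW J v.1 a.1) * ∑ z ∈ Pl L, (Gi J L a z + Gi J L v z) := by
        rw [Finset.sum_add_distrib, Finset.sum_comm]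
        simp only [Finset.mul_sum]
    _ ≤ 1 + ∑ v : ↥(box 3 L), (twinW J a.1 v.1 + twinW J v.1 a.1) * (Ssum J L a + Ssum J L v) := by
        refine add_le_add ?_ (le_of_eq (Finset.sum_congr rfl fun v _ => ?_))
        · calc (∑ z ∈ Pl L, if z = a then (1 : ℝ) else 0)
              ≤ ∑ z : ↥(box 3 L), if z = a then (1 : ℝ) else 0 :=
                Finset.sum_le_univ_sum_of_nonneg fun z => by split_ifs <;> norm_num
            _ = 1 := by rw [Finset.sum_ite_eq']; simp
        · rw [Finset.sum_add_distrib]; rfl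

/-- **Half-space renewal** (Lieb–Simon with `B` a part of the box missing the plane), summed over the plane:
`S(v) ≤ ∑_{u ∈ B} ∑_{w ∉ B} (c_{uw} + c_{wu}) ⟨σ_vσ_u⟩_{c|_B} (S(u) + S(w))`.
[cite: AizenmanDuminilCopinAnnals2021, Lemma 5.7] -/
theorem renewal_half {J : ℝ} (hJ : 0 ≤ J) (L : ℕ) (B : Finset ↥(box 3 L)) (hB : ∀ z ∈ Pl L, z ∉ B)
    {v : ↥(box 3 L)} (hv : v ∈ B) :
    Ssum J L v ≤ ∑ u : ↥B, ∑ w ∈ Bᶜ, (twinW J u.1.1 w.1 + twinW J w.1 u.1.1) *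
      PairIsing.avg (fun a' b' : ↥B => twinCpl J L a' b') (spinPair ⟨v, hv⟩ u) * (Ssum J L u + Ssum J L w) := by
  have hc := twinCpl_nonneg hJ L
  calc Ssum J L v = ∑ z ∈ Pl L, Gi J L v z := rfl
    _ ≤ ∑ z ∈ Pl L, ∑ u : ↥B, ∑ w ∈ Bᶜ, (twinW J u.1.1 w.1 + twinW J w.1 u.1.1) *
          PairIsing.avg (fun a' b' : ↥B => twinCpl J L a' b') (spinPair ⟨v, hv⟩ u) * (Gi J L u z + Gi J L w z) :=
        Finset.sum_le_sum fun z hz => PairIsing.liebSimon (twinCpl J L) (fun a b _ => hc a b) B hv (hB z hz)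
    _ = _ := by
        rw [Finset.sum_comm]
        refine Finset.sum_congr rfl fun u _ => ?_
        rw [Finset.sum_comm]
        refine Finset.sum_congr rfl fun w _ => ?_
        rw [← Finset.mul_sum, Finset.sum_add_distrib]
        rfl

end Summit.CriticalPhenomena.Ising3DConformalLimit.Cruxes.TwinThreshold.SeamRenewal.PlaneSummable

namespace Summit.CriticalPhenomena.Ising3DConformalLimit.Cruxes.TwinThreshold.SeamRenewal

open Literature.Probability.LatticeModels

/-- **Registered sub-goal of part II** (anchor of this helper file on the crux item): the one-site Lieb–Simon bound for a
nonnegative pair interaction on a finite set (`PlaneSummable.liebSimon_singleton`). [cite: AizenmanDuminilCopinAnnals2021, Lemma 5.7] -/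
theorem stub_planeSummable_partII_liebSimonSite : open Literature.Probability.LatticeModels in (∀ {ι : Type} [Fintype ι] [DecidableEq ι] (c : ι → ι → ℝ), (∀ a b, 0 ≤ c a b) → ∀ a z : ι, z ≠ a → PairIsing.avg c (spinPair a z) ≤ ∑ v, (c a v + c v a) * (PairIsing.avg c (spinPair a z) + PairIsing.avg c (spinPair v z))) :=
  fun c hc _ _ hz => PlaneSummable.liebSimon_singleton c hc hz

end Summit.CriticalPhenomena.Ising3DConformalLimit.Cruxes.TwinThreshold.SeamRenewal

end
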